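import Summits.CriticalPhenomena.PercolationContinuityZ3.Theorems.PercNearOneGluingNoHeavyQuantCountDP
import HarnessLib

/-!
# QUANT lane R8 tool: for NONDECREASING trial probabilities the expected sojourn time `Σ_{m ≤ K} P(S_m = i)` of the success count
# at a level `i` is NONINCREASING in the level

builds on p205010 (kernel theorem, internal audit signed; external expert review pending)

Support file (`--supports stmt-CriticalPhenomena-4575`), QUANT lane seat prim-quant-p1 (gen 7); memo
`run/shared/lean/prim/quant/P1-SURPLUS.md` §18; companion of `…QuantCountDP.lean` (the recursion `PB[p, m]`) and `…QuantSojourn.lean` (the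
SOJOURN LEMMA `Quant.CountDP.sojourn_ge_one`, the law-free core of FAR at every layer on combs).  Pure real algebra on the recursion; no
probability space, no definitions (the local `PB` notation of `…QuantCountDP.lean`), no sorries, standard axioms.

**Why.**  For 'root blobs + a comb' (P1-SURPLUS §18: independent root blocks `B` plus a chain with single hairs read from a least likely relay
`a`) the chain decomposition gives `P(N ≥ j+1) ≥ P(B ≥ j+1) + x · Σ_{m ≤ K} P(B + S_m = j) = E[φ(B)]` with `φ(s) = x · g(j − s)`,
`g(i) = Σ_{m ≤ K} P(S_m = i)` the SOJOURN PROFILE of the hair-success walk, and at the realisable tied vertex the hair probabilities are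
nondecreasing root-first.  The lemma below says that THEN `g` is nonincreasing, i.e. `φ` is a nondecreasing function of the block count — the
structural half of the tied-vertex inequality (BSS-mono of the memo; census 514 425 / 0).  It is FALSE without monotonicity
(`p = (1, ε, ε, …)`: `g(1) ≈ K ≫ g(0) = 1`; 1 344 / 3 000 random orders violate it), which is one more place where the tree's root-first
order is used.

* `Quant.CountDP.sojourn_head` — head split of the sojourn profile: `g_{K+1}[p](i) = [i = 0] + p 0 · g_K[p∘succ](i−1) + (1 − p 0) · g_K[p∘succ](i)`.
* `Quant.CountDP.PB_zero_le_pow_of_monotone` — `PB[p∘succ, m] 0 ≤ (1 − p 0)^m` when `p` is nondecreasing; `Quant.CountDP.head_mul_geom_sum` —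
  `p₀ · Σ_{m ≤ K} (1 − p₀)^m = 1 − (1 − p₀)^{K+1}`; hence `p 0 · g_K[p∘succ](0) ≤ 1` (`head_mul_sojourn_zero_le_one`).
* `Quant.CountDP.sojourn_antitone` — **for `0 ≤ p k ≤ 1` nondecreasing in `k` and every `K`, `i`:
  `Σ_{m ≤ K} PB[p, m] (i+1) ≤ Σ_{m ≤ K} PB[p, m] i`.**  Induction on `K` through the head split: for `i ≥ 1` both brackets are instances of the
  claim for `p ∘ succ`; for `i = 0` the extra unit `[i = 0] = 1` pays for `p 0 · g_K[p∘succ](0) ≤ 1`.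
Exact re-check: `prim-quant-p1-g7/evidence/gmono.py` (8 007 nondecreasing sequences on a grid, 0 violations). [this work]
-/

noncomputable section

namespace Summit.CriticalPhenomena.PercolationContinuityZ3.Theorems

namespace Quant

namespace CountDP

open Finset

/-- `PB[p, m] b` = probability that exactly `b` of the first `m` independent trials succeed (recursion on `m`, as in `…QuantCountDP.lean`). -/
local notation3 "PB[" p ", " m "]" =>
  (Nat.rec (motive := fun _ => ℕ → ℝ) (fun b => if b = 0 then (1 : ℝ) else 0)
    (fun n f b => (p : ℕ → ℝ) n * (if b = 0 then (0 : ℝ) else f (b - 1)) + (1 - (p : ℕ → ℝ) n) * f b) (m : ℕ))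

variable (p : ℕ → ℝ)

/-! ### Head split of the sojourn profile -/

/-- **Head split of the sojourn profile.**  With `p' = p ∘ succ`:
`Σ_{m ≤ K+1} PB[p, m] i = [i = 0] + Σ_{m ≤ K} (p 0 · [i ≠ 0] · PB[p', m] (i−1) + (1 − p 0) · PB[p', m] i)`. [this work] -/
theorem sojourn_head (K i : ℕ) :
    ∑ m ∈ Finset.range (K + 2), PB[p, m] i =
      (if i = 0 then (1 : ℝ) else 0) +
        ∑ m ∈ Finset.range (K + 1),
          (p 0 * (if i = 0 then (0 : ℝ) else PB[(fun k => p (k + 1)), m] (i - 1)) +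
            (1 - p 0) * PB[(fun k => p (k + 1)), m] i) := by
  rw [Finset.sum_range_succ']
  rw [PB_zero, add_comm]
  congr 1
  exact Finset.sum_congr rfl fun m _ => PB_head p m i

/-- Head split of the sojourn profile at a positive level: `g_{K+1}[p](i+1) = p 0 · g_K[p'](i) + (1 − p 0) · g_K[p'](i+1)`. [this work] -/
theorem sojourn_head_succ (K i : ℕ) :
    ∑ m ∈ Finset.range (K + 2), PB[p, m] (i + 1) =
      p 0 * ∑ m ∈ Finset.range (K + 1), PB[(fun k => p (k + 1)), m] i +
        (1 - p 0) * ∑ m ∈ Finset.range (K + 1), PB[(fun k => p (k + 1)), m] (i + 1) := by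
  rw [sojourn_head, Finset.mul_sum, Finset.mul_sum, ← Finset.sum_add_distrib]
  simp

/-- Head split of the sojourn profile at level zero: `g_{K+1}[p](0) = 1 + (1 − p 0) · g_K[p'](0)`. [this work] -/
theorem sojourn_head_zero (K : ℕ) :
    ∑ m ∈ Finset.range (K + 2), PB[p, m] 0 =
      1 + (1 - p 0) * ∑ m ∈ Finset.range (K + 1), PB[(fun k => p (k + 1)), m] 0 := by
  rw [sojourn_head, Finset.mul_sum]
  simp

/-! ### The head unit pays for the shifted sojourn at level zero -/

/-- For nondecreasing `p` with values in `[0,1]`: `PB[p ∘ succ, m] 0 = ∏_{k<m} (1 − p (k+1)) ≤ (1 − p 0)^m`. [this work] -/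
theorem PB_zero_le_pow_of_monotone (hp : ∀ k, 0 ≤ p k ∧ p k ≤ 1) (hmono : Monotone p) (m : ℕ) :
    PB[(fun k => p (k + 1)), m] 0 ≤ (1 - p 0) ^ m := by
  induction m with
  | zero => rw [PB_zero_zero, pow_zero]
  | succ m ih =>
    rw [PB_succ_zero (fun k => p (k + 1)) m, pow_succ, mul_comm]
    have h1 : 1 - p (m + 1) ≤ 1 - p 0 := by linarith [hmono (Nat.zero_le (m + 1))]
    have h2 : 0 ≤ 1 - p (m + 1) := by linarith [hp (m + 1)]
    have h3 : 0 ≤ PB[(fun k => p (k + 1)), m] 0 := PB_nonneg (fun k => p (k + 1)) (fun k => hp (k + 1)) m 0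
    exact mul_le_mul ih h1 h2 (pow_nonneg (by linarith [hp 0]) m)

/-- Geometric bookkeeping: `p₀ · Σ_{m ≤ K} (1 − p₀)^m = 1 − (1 − p₀)^{K+1}`. [folklore] -/
theorem head_mul_geom_sum (p₀ : ℝ) (K : ℕ) :
    p₀ * ∑ m ∈ Finset.range (K + 1), (1 - p₀) ^ m = 1 - (1 - p₀) ^ (K + 1) := by
  induction K with
  | zero => simp
  | succ K ih =>
    rw [Finset.sum_range_succ, mul_add, ih, pow_succ, pow_succ]
    ring

/-- For nondecreasing `p` in `[0,1]`: `p 0 · Σ_{m ≤ K} PB[p ∘ succ, m] 0 ≤ 1` — the sojourn at level `0` of the shifted walk is at most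
`1 / p 0` (every shifted trial fails with probability `≤ 1 − p 0`). [this work] -/
theorem head_mul_sojourn_zero_le_one (hp : ∀ k, 0 ≤ p k ∧ p k ≤ 1) (hmono : Monotone p) (K : ℕ) :
    p 0 * ∑ m ∈ Finset.range (K + 1), PB[(fun k => p (k + 1)), m] 0 ≤ 1 := by
  have hle : ∑ m ∈ Finset.range (K + 1), PB[(fun k => p (k + 1)), m] 0 ≤ ∑ m ∈ Finset.range (K + 1), (1 - p 0) ^ m :=
    Finset.sum_le_sum fun m _ => PB_zero_le_pow_of_monotone p hp hmono m
  have h0 : 0 ≤ p 0 := (hp 0).1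
  calc p 0 * ∑ m ∈ Finset.range (K + 1), PB[(fun k => p (k + 1)), m] 0
      ≤ p 0 * ∑ m ∈ Finset.range (K + 1), (1 - p 0) ^ m := mul_le_mul_of_nonneg_left hle h0
    _ = 1 - (1 - p 0) ^ (K + 1) := head_mul_geom_sum (p 0) K
    _ ≤ 1 := by
        have : 0 ≤ (1 - p 0) ^ (K + 1) := pow_nonneg (by linarith [hp 0]) _
        linarith

/-! ### The sojourn profile is nonincreasing in the level -/

/-- **Sojourn profile antitone in the level.**  If `0 ≤ p k ≤ 1` and `p` is nondecreasing, then for every horizon `K` and level `i`: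
`Σ_{m ≤ K} PB[p, m] (i+1) ≤ Σ_{m ≤ K} PB[p, m] i` — the success count of the first `m` trials, summed over `m ≤ K`, spends no more
expected time at level `i+1` than at level `i`.  (False for non-monotone `p`, e.g. `p = (1, ε, …, ε)`.) [this work] -/
theorem sojourn_antitone : ∀ (p : ℕ → ℝ), (∀ k, 0 ≤ p k ∧ p k ≤ 1) → Monotone p → ∀ (K i : ℕ),
    ∑ m ∈ Finset.range (K + 1), PB[p, m] (i + 1) ≤ ∑ m ∈ Finset.range (K + 1), PB[p, m] i := by
  intro p hp hmono K
  induction K generalizing p with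
  | zero =>
    intro i
    rw [Finset.sum_range_one, Finset.sum_range_one, PB_zero, PB_zero]
    rw [if_neg (Nat.add_one_ne_zero i)]
    by_cases hi : i = 0
    · rw [if_pos hi]; norm_num
    · rw [if_neg hi]
  | succ K ih =>
    intro i
    have hp' : ∀ k, 0 ≤ (fun k => p (k + 1)) k ∧ (fun k => p (k + 1)) k ≤ 1 := fun k => hp (k + 1)
    have hmono' : Monotone (fun k => p (k + 1)) := fun a b hab => hmono (Nat.succ_le_succ hab)
    have ih' := ih (fun k => p (k + 1)) hp' hmono'
    have h0 : 0 ≤ p 0 := (hp 0).1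
    have h1 : 0 ≤ 1 - p 0 := by linarith [hp 0]
    cases i with
    | zero =>
      -- level `0` versus level `1`: the head unit pays for `p 0 · g'(0) ≤ 1`
      rw [sojourn_head_zero, show (0 : ℕ) + 1 = 0 + 1 from rfl, sojourn_head_succ]
      have hA := head_mul_sojourn_zero_le_one p hp hmono K
      have hB := mul_le_mul_of_nonneg_left (ih' 0) h1
      linarith
    | succ i =>
      rw [sojourn_head_succ, sojourn_head_succ]
      have hA := mul_le_mul_of_nonneg_left (ih' i) h0
      have hB := mul_le_mul_of_nonneg_left (ih' (i + 1)) h1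
      linarith

end CountDP

end Quant

end Summit.CriticalPhenomena.PercolationContinuityZ3.Theorems

end
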